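import Mathlib
import HarnessLib
import Literature.Analysis.FunctionSpaces.WeakLp
import Summits.NavierStokesRegularity.NavierStokesRegularity.Theses.StretchingWellBinding
import Summits.NavierStokesRegularity.NavierStokesRegularity.Theses.TypeILiouville
import Summits.NavierStokesRegularity.NavierStokesRegularity.Theses.TypeIQuarterGate
import Summits.NavierStokesRegularity.NavierStokesRegularity.Theorems.LerayQuarterDissipationRecordTimeTypeI
import Summits.NavierStokesRegularity.NavierStokesRegularity.Theorems.StretchingWellBindingEnstrophyQuarterLawVolumeSparse
import Summits.NavierStokesRegularity.NavierStokesRegularity.Theorems.StretchingWellBindingEnstrophyQuarterLawFastSetBudget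
import Summits.NavierStokesRegularity.NavierStokesRegularity.Theorems.StretchingWellBindingEnstrophyQuarterLawVorticityTypeI
import Summits.NavierStokesRegularity.NavierStokesRegularity.Theorems.StretchingWellBindingEnstrophyQuarterLawLambSlaving

/-!
# Shelf 1574, line `lamb_budget`: ASSEMBLY — the corollary for route TypeIQuarterGate cashed, and the
# line's net statement by name

Helper file (`--supports stmt-NavierStokesRegularity-1574 --as helper`; director KEY-NS #114 (2): «stubs 1/5/3 ⇒
`quarterLawTypeI_of_lorentzUpgrade` cashes TIQG 23726 ⇐ 24108 conditionally»). With stubs 1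
(`LambBudget.enstrophySlavedToIntenseLamb`), 3 (`LambBudget.vorticityTypeIOfTypeI`), 5 (`LambBudget.fastSetBudget`)
and 6 (`LambBudget.volumeSparseOfSlice`) of ns-idea-9's LINE 7 `Cruxes/EnstrophyQuarterLaw/Lines/lamb_budget.lean`
now tree theorems, the line's compositions become UNCONDITIONAL implications between named open statements:

* `quarterLawTypeI_of_lorentzUpgrade : TypeIQuarterGate.LorentzUpgradeTypeI → TypeIQuarterGate.QuarterLawTypeI`
  — TIQG's deciding crux stmt-23726 from its own rank-4 crux stmt-24108 DIRECTLY (weak-`L³` at one level is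
  volume sparseness, `volumeSparse_of_weakL3`, adapted verbatim from the line file; Type I + volume sparseness
  is the quarter law by the Lamb slaving): no scar count (23842), no scar envelope (23843), no profile, no
  Liouville;
* `enstrophyQuarterLaw_of_noTypeII_of_lorentzUpgrade : TypeILiouville.TypeIliouvilleNoTypeII →
  LorentzUpgradeTypeI → StretchingWellBinding.EnstrophyQuarterLaw` (shelf level);
* `enstrophyQuarterLaw_of_noTypeII_of_volumeSparsenessLaw` — the line's forward skeleton theorem
  `EnstrophyQuarterLaw ⇐ 0056 ∧ B` with `B = VolumeSparsenessLaw` UNFOLDED VERBATIM and stubs 1, 3, 5 discharged;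
* `sliceLaw_iff_typeI_and_volumeSparse` — the line's headline PER SOLUTION, now with no hypotheses beyond the
  solution: for every `c₀ ∈ (0,1)`, slice quarter law ⟺ (sup-rate Type I ∧ volume sparseness at `c₀`).

HONEST FRAMING: conditional edges between OPEN statements (`EnstrophyQuarterLaw` 1574, `TypeIliouvilleNoTypeII`
0056, `QuarterLawTypeI` 23726, `LorentzUpgradeTypeI` 24108, `VolumeSparsenessLaw`); nothing about Navier–Stokes
regularity is asserted and no crux is closed. Credit: the decomposition, the statements and `volumeSparse_of_weakL3`
are ns-idea-9 g3's (line card `Lines/lamb_budget.md`); this seat only lands them. No summit statement is proved.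
-/

noncomputable section

-- the summit-side namespace repeats a component by design (D-0017)
set_option linter.dupNamespace false

namespace Summit.NavierStokesRegularity.NavierStokesRegularity.Theorems.EnstrophyQuarterLaw.LambBudget

open Set MeasureTheory Function Metric Filter Topology
open scoped ENNReal NNReal
open Literature.Analysis.FluidPDE
open Summit.NavierStokesRegularity.NavierStokesRegularity

/-! ### Weak-`L³` at one level is volume sparseness (ns-idea-9's proved lemma, Theorems copy) -/

/-- **Weak-`L³` at one level is volume sparseness** (`volumeSparse_of_weakL3` of `Lines/lamb_budget.lean`, with
`VolumeSparse` unfolded): if `‖u(t)‖³_{L^{3,∞}} ≤ M'` (`eWeakLpPow (u t) 3 volume ≤ ofReal M'`) on `[0,T)`, then for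
every `c₀ > 0`, `ν > 0` the fast set `{|u(s)| > c₀√(ν/(T−s))}` has measure `≤ N (√(ν(T−s)))³` with
`N = M'⁺/(c₀³ν³)` (Chebyshev at the single level `λ = c₀√(ν/(T−s))`, `λ√(ν(T−s)) = c₀ν`).
-- adapted verbatim from Cruxes/EnstrophyQuarterLaw/Lines/lamb_budget.lean (ns-idea-9 g3). [folklore] -/
theorem volumeSparse_of_weakL3 {c₀ ν T : ℝ} (hc₀ : 0 < c₀) (hν : 0 < ν)
    {u : ℝ → EuclideanSpace ℝ (Fin 3) → EuclideanSpace ℝ (Fin 3)} {M' : ℝ}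
    (hM : ∀ t ∈ Set.Ico 0 T,
      Literature.Analysis.FunctionSpaces.eWeakLpPow (u t) 3 volume ≤ ENNReal.ofReal M') :
    ∃ N : ℝ, ∀ s ∈ Set.Ico 0 T,
      volume {x : EuclideanSpace ℝ (Fin 3) | c₀ * Real.sqrt (ν / (T - s)) < ‖u s x‖} ≤
        ENNReal.ofReal (N * Real.sqrt (ν * (T - s)) ^ 3) := by
  refine ⟨max M' 0 / (c₀ ^ 3 * ν ^ 3), fun s hs => ?_⟩
  have hTs : 0 < T - s := sub_pos.2 hs.2
  have hS : 0 < Real.sqrt (ν * (T - s)) := Real.sqrt_pos.2 (mul_pos hν hTs)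
  have hlam_pos : 0 < c₀ * Real.sqrt (ν / (T - s)) :=
    mul_pos hc₀ (Real.sqrt_pos.2 (div_pos hν hTs))
  have hkey : c₀ * Real.sqrt (ν / (T - s)) * Real.sqrt (ν * (T - s)) = c₀ * ν := by
    rw [mul_assoc, ← Real.sqrt_mul (div_pos hν hTs).le]
    congr 1
    rw [show ν / (T - s) * (ν * (T - s)) = ν ^ 2 by field_simp]
    exact Real.sqrt_sq hν.le
  have hlam_eq : c₀ * Real.sqrt (ν / (T - s)) = c₀ * ν / Real.sqrt (ν * (T - s)) := by
    rw [eq_div_iff hS.ne']; exact hkey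
  have hlev := (Literature.Analysis.FunctionSpaces.rpow_mul_meas_lt_le_eWeakLpPow (u s) 3 volume
    (c₀ * Real.sqrt (ν / (T - s))).toNNReal).trans (hM s hs)
  have hset : {x | (((c₀ * Real.sqrt (ν / (T - s))).toNNReal : ℝ≥0) : ℝ≥0∞) < ‖u s x‖ₑ}
      = {x : EuclideanSpace ℝ (Fin 3) | c₀ * Real.sqrt (ν / (T - s)) < ‖u s x‖} := by
    ext x
    simp only [Set.mem_setOf_eq, enorm_eq_nnnorm, ENNReal.coe_lt_coe, ← NNReal.coe_lt_coe,
      Real.coe_toNNReal _ hlam_pos.le, coe_nnnorm]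
  have h3 : (3 : ℝ≥0∞).toReal = ((3 : ℕ) : ℝ) := by norm_num
  have hcoe : (((c₀ * Real.sqrt (ν / (T - s))).toNNReal : ℝ≥0) : ℝ≥0∞) ^ ((3 : ℕ) : ℝ)
      = ENNReal.ofReal ((c₀ * Real.sqrt (ν / (T - s))) ^ 3) := by
    rw [ENNReal.rpow_natCast, ENNReal.ofReal, Real.toNNReal_pow hlam_pos.le, ENNReal.coe_pow]
  rw [hset, h3, hcoe] at hlev
  have hlam3 : 0 < (c₀ * Real.sqrt (ν / (T - s))) ^ 3 := pow_pos hlam_pos 3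
  have hF : volume {x : EuclideanSpace ℝ (Fin 3) | c₀ * Real.sqrt (ν / (T - s)) < ‖u s x‖} ≤
      ENNReal.ofReal M' / ENNReal.ofReal ((c₀ * Real.sqrt (ν / (T - s))) ^ 3) := by
    rw [ENNReal.le_div_iff_mul_le (Or.inl (ENNReal.ofReal_pos.2 hlam3).ne') (Or.inl ENNReal.ofReal_ne_top)]
    rwa [mul_comm] at hlev
  refine hF.trans ?_
  rw [← ENNReal.ofReal_div_of_pos hlam3]
  apply ENNReal.ofReal_le_ofReal
  have hcν : 0 < (c₀ * ν) ^ 3 := by positivity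
  calc M' / (c₀ * Real.sqrt (ν / (T - s))) ^ 3
        = M' * Real.sqrt (ν * (T - s)) ^ 3 / (c₀ * ν) ^ 3 := by
          rw [hlam_eq, div_pow, div_div_eq_mul_div]
    _ ≤ max M' 0 * Real.sqrt (ν * (T - s)) ^ 3 / (c₀ * ν) ^ 3 := by
          gcongr
          exact le_max_left _ _
    _ = max M' 0 / (c₀ ^ 3 * ν ^ 3) * Real.sqrt (ν * (T - s)) ^ 3 := by
          rw [mul_pow]; ring

/-! ### The corollary for route TypeIQuarterGate, cashed -/

/-- **TIQG's deciding crux from its own Lorentz-upgrade crux, directly: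
`LorentzUpgradeTypeI → QuarterLawTypeI`** (stmt-23726 ⇐ stmt-24108, by name, no other hypothesis). At a
Type-I first blow-up, the uniform weak-`L³` bound is volume sparseness at the threshold `c₀ = 1/2`
(`volumeSparse_of_weakL3`), Type I for `u` gives Type I for `curl u` (`vorticityTypeIOfTypeI`), the fast-set
budget follows (`fastSetBudget`), and the Lamb slaving (`enstrophySlavedToIntenseLamb`) returns the slice
quarter law. The layer «LorentzUpgrade → FiniteScars (23842) → ScarEnvelope (23843) → QuarterLawTypeI» of
route TypeIQuarterGate is thereby bypassed: «LorentzUpgrade → Chebyshev → Lamb slaving». A conditional edge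
between two OPEN statements. [folklore] -/
theorem quarterLawTypeI_of_lorentzUpgrade
    (hL : Summit.NavierStokesRegularity.NavierStokesRegularity.Theses.TypeIQuarterGate.LorentzUpgradeTypeI) :
    Summit.NavierStokesRegularity.NavierStokesRegularity.Theses.TypeIQuarterGate.QuarterLawTypeI := by
  intro ν T hν hT u p hmax hLH hdec hTI
  obtain ⟨M', hM⟩ := hL ν T hν hT u p hmax hLH hdec hTI
  exact enstrophySlavedToIntenseLamb (1 / 2) (by norm_num) (by norm_num) ν T hν hT u p hmax hLH hdec
    (fastSetBudget (1 / 2) (by norm_num) ν T hν hT u p hmax hLH hdec hTI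
      (vorticityTypeIOfTypeI ν T hν hT u p hmax hLH hdec hTI)
      (volumeSparse_of_weakL3 (by norm_num) hν hM))

/-- **Shelf level: `EnstrophyQuarterLaw ⇐ 0056 ∧ 24108`** — the Type-I wall `TypeIliouvilleNoTypeII`
(stmt-0056) and TIQG's Lorentz upgrade (stmt-24108) give the enstrophy quarter law (stmt-1574), by name.
Conditional edge only. [folklore] -/
theorem enstrophyQuarterLaw_of_noTypeII_of_lorentzUpgrade
    (hII : Summit.NavierStokesRegularity.NavierStokesRegularity.Theses.TypeILiouville.TypeIliouvilleNoTypeII)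
    (hL : Summit.NavierStokesRegularity.NavierStokesRegularity.Theses.TypeIQuarterGate.LorentzUpgradeTypeI) :
    Summit.NavierStokesRegularity.NavierStokesRegularity.Theses.StretchingWellBinding.EnstrophyQuarterLaw := by
  intro ν T hν hT u p hmax hLH hdec
  exact quarterLawTypeI_of_lorentzUpgrade hL ν T hν hT u p hmax hLH hdec (hII ν T hν hT u p hmax hLH hdec)

/-! ### The line's net statement by name: `EnstrophyQuarterLaw ⇐ 0056 ∧ VolumeSparsenessLaw` -/

/-- **The skeleton theorem of LINE 7 with stubs 1, 3, 5 discharged: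
`TypeIliouvilleNoTypeII → VolumeSparsenessLaw → EnstrophyQuarterLaw`** (`VolumeSparsenessLaw` — the line's
new crux `B`: for SOME `c₀ ∈ (0,1)`, at every first blow-up the fast set is volume sparse — UNFOLDED
VERBATIM). So on shelf 1574, modulo the Type-I wall the quarter law is EXACTLY a Lebesgue-measure statement
about a velocity super-level set (the converse is `volumeSparse_of_enstrophyQuarterLaw`). Conditional edge only.
[folklore] -/
theorem enstrophyQuarterLaw_of_noTypeII_of_volumeSparsenessLaw
    (hII : Summit.NavierStokesRegularity.NavierStokesRegularity.Theses.TypeILiouville.TypeIliouvilleNoTypeII)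
    (hB : ∃ c₀ : ℝ, 0 < c₀ ∧ c₀ < 1 ∧
      ∀ (ν T : ℝ), 0 < ν → 0 < T →
        ∀ (u : ℝ → EuclideanSpace ℝ (Fin 3) → EuclideanSpace ℝ (Fin 3))
          (p : ℝ → EuclideanSpace ℝ (Fin 3) → ℝ),
        IsMaximalSmoothSolution ν 0 u p T → IsLerayHopfOn T ν 0 (u 0) u → HasRapidSpatialDecay (u 0) →
        ∃ N : ℝ, ∀ s ∈ Set.Ico 0 T,
          volume {x : EuclideanSpace ℝ (Fin 3) | c₀ * Real.sqrt (ν / (T - s)) < ‖u s x‖} ≤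
            ENNReal.ofReal (N * Real.sqrt (ν * (T - s)) ^ 3)) :
    Summit.NavierStokesRegularity.NavierStokesRegularity.Theses.StretchingWellBinding.EnstrophyQuarterLaw := by
  intro ν T hν hT u p hmax hLH hdec
  obtain ⟨c₀, hc₀, hc₁, hVS⟩ := hB
  have hTI : IsTypeIBlowup u T := hII ν T hν hT u p hmax hLH hdec
  exact enstrophySlavedToIntenseLamb c₀ hc₀ hc₁ ν T hν hT u p hmax hLH hdec
    (fastSetBudget c₀ hc₀ ν T hν hT u p hmax hLH hdec hTI (vorticityTypeIOfTypeI ν T hν hT u p hmax hLH hdec hTI)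
      (hVS ν T hν hT u p hmax hLH hdec))

/-- **The line's headline, per solution and now hypothesis-free:** for every `c₀ ∈ (0,1)` and every maximal
classical Leray–Hopf solution from a rapidly decaying datum, the slice quarter law
`∃ K, ∫|curl u(t)|² ≤ K/√(T−t)` on `[0,T)` holds IFF the blow-up is sup-rate Type I AND the fast set at
threshold `c₀` is volume sparse (`⇒`: record-time Type I `lerayQuarterDissipation_recordTimeTypeI_proof` +
`volumeSparseOfSlice`; `⇐`: `vorticityTypeIOfTypeI` + `fastSetBudget` + `enstrophySlavedToIntenseLamb`).
[folklore] -/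
theorem sliceLaw_iff_typeI_and_volumeSparse {c₀ : ℝ} (hc₀ : 0 < c₀) (hc₁ : c₀ < 1) {ν T : ℝ}
    (hν : 0 < ν) (hT : 0 < T) {u : ℝ → EuclideanSpace ℝ (Fin 3) → EuclideanSpace ℝ (Fin 3)}
    {p : ℝ → EuclideanSpace ℝ (Fin 3) → ℝ} (hmax : IsMaximalSmoothSolution ν 0 u p T)
    (hLH : IsLerayHopfOn T ν 0 (u 0) u) (hdec : HasRapidSpatialDecay (u 0)) :
    (∃ K : ℝ, ∀ t ∈ Set.Ico 0 T, ∫⁻ x, ‖curl (u t) x‖ₑ ^ 2 ≤ ENNReal.ofReal (K / Real.sqrt (T - t))) ↔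
      (IsTypeIBlowup u T ∧ ∃ N : ℝ, ∀ s ∈ Set.Ico 0 T,
        volume {x : EuclideanSpace ℝ (Fin 3) | c₀ * Real.sqrt (ν / (T - s)) < ‖u s x‖} ≤
          ENNReal.ofReal (N * Real.sqrt (ν * (T - s)) ^ 3)) := by
  constructor
  · rintro ⟨K, hK⟩
    have hTI : IsTypeIBlowup u T :=
      Summit.NavierStokesRegularity.NavierStokesRegularity.Theorems.lerayQuarterDissipation_recordTimeTypeI_proof
        ν T hν hT u p hmax.1 hLH hdec K hK
    exact ⟨hTI, volumeSparseOfSlice c₀ hc₀ ν T hν hT u p hmax hLH hdec ⟨K, hK⟩⟩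
  · rintro ⟨hTI, hV⟩
    exact enstrophySlavedToIntenseLamb c₀ hc₀ hc₁ ν T hν hT u p hmax hLH hdec
      (fastSetBudget c₀ hc₀ ν T hν hT u p hmax hLH hdec hTI (vorticityTypeIOfTypeI ν T hν hT u p hmax hLH hdec hTI)
        hV)

end Summit.NavierStokesRegularity.NavierStokesRegularity.Theorems.EnstrophyQuarterLaw.LambBudget

end
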